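import Literature.AlgebraicTopology.Homotopy.CollarPush
import Mathlib.Topology.Homotopy.Contractible
import HarnessLib

/-!
# Closed collars `κ(A × [0, s])`: their complements are contractible cofinal neighbourhoods of the cores

Topic `Literature/AlgebraicTopology/Homotopy`, a complement to `CollarPush.lean` (same notion
`Literature.AlgebraicTopology.Homotopy.BoundaryCollar`: a closed embedding `κ : A × [0, 1] → W` with
`κ(A × [0, 1))` open; think of `κ(A × {0})` as the boundary of `W`). For a level `s` write
`slab s = κ(A × [0, s])` (a compact, hence closed, set when `A` is compact) and recall the *core*
`core t = W ∖ κ(A × [0, t))` of `CollarPush.lean`. This file proves: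

* `BoundaryCollar.core_subset_compl_slab`: `core t ⊆ W ∖ slab s` for `s < t`, and
  `W ∖ slab s ⊆ κ.interior`;
* `BoundaryCollar.contractibleSpace_compl_slab`: for `W` contractible and `s < 1`, the open set
  `W ∖ slab s` is contractible — it is stable under the collar pushes and the push to level `1`
  retracts `W` into it, so its inclusion in `W` is a homotopy equivalence
  (`BoundaryCollar.inclusionHomotopyEquiv`);
* `BoundaryCollar.exists_compl_slab_subset` (**cofinality**): for `W` compact, every open
  `O ⊇ core t` (`t > 0`) contains `W ∖ slab s` for some `s < t` — the compact set `W ∖ O` lies in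
  `κ(A × [0, t))`, so its set of levels is compact and bounded away from `t`;
* `BoundaryCollar.exists_contractible_open_nhd_core`: hence every open neighbourhood of a core of
  a compact contractible collared `W` contains a contractible open neighbourhood of the core.

These are the point-set inputs by which Alexander duality at the compact core of a contractible
bounding manifold (seen in its interior) is invoked in the proof of the Poincaré duality step of
Kervaire–Milnor's Lemma 2.3 (`Literature/Topology/FourManifolds/`). Everything is proved; Mathlib
has no collars (compare `CollarPush.lean`).

## References

* A. Hatcher, *Algebraic Topology*, CUP (2002), p. 253 (collar neighbourhoods), Prop. 3.42
  (existence of collars on compact manifolds with boundary). [HatcherAT2002]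
-/

noncomputable section

open Set Function
open scoped unitInterval Topology ContinuousMap

universe u v

namespace Literature.AlgebraicTopology.Homotopy

namespace BoundaryCollar

variable {W : Type u} [TopologicalSpace W] {A : Type v} [TopologicalSpace A]
  (κ : BoundaryCollar W A)

/-! ### Closed collars -/

/-- The **closed collar** `κ(A × [0, s])` up to level `s`. [folklore] -/
def slab (s : I) : Set W := κ.collar '' {q | q.2 ≤ s}

/-- Membership of a collar point in a closed collar: `κ q ∈ slab s ↔ q.2 ≤ s`. [folklore] -/
@[simp] theorem collar_mem_slab_iff {q : A × I} {s : I} : κ.collar q ∈ κ.slab s ↔ q.2 ≤ s :=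
  κ.collar_mem_image_iff

/-- The open collar up to level `s` lies in the closed collar up to level `s`. [folklore] -/
theorem below_subset_slab (s : I) : κ.below s ⊆ κ.slab s :=
  image_mono fun _ (hq : _ < s) => hq.le

/-- A point outside the closed collar up to level `s` lies in the core at level `s`. [folklore] -/
theorem mem_core_of_not_mem_slab {s : I} {w : W} (hw : w ∉ κ.slab s) : w ∈ κ.core s :=
  fun h => hw (κ.below_subset_slab s h)

/-- **The core at level `t` misses the closed collar up to any lower level `s < t`.** [folklore] -/
theorem core_subset_compl_slab {s t : I} (hst : s < t) : κ.core t ⊆ (κ.slab s)ᶜ := by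
  rintro w hw ⟨q, hq, rfl⟩
  rw [collar_mem_core_iff] at hw
  exact absurd (lt_of_lt_of_le hst hw) (not_lt.2 hq)

/-- The complement of a closed collar lies in the interior of the collar. [folklore] -/
theorem compl_slab_subset_interior (s : I) : (κ.slab s)ᶜ ⊆ κ.interior := by
  intro w hw
  rw [mem_interior_iff]
  rintro a rfl
  exact hw ⟨(a, 0), (s.2.1 : (0 : I) ≤ s), rfl⟩

/-- For `A` compact, the closed collar `κ(A × [0, s])` is compact. [folklore] -/
theorem isCompact_slab [CompactSpace A] (s : I) : IsCompact (κ.slab s) :=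
  (isClosed_le continuous_snd continuous_const).isCompact.image κ.continuous

/-- For `A` compact (and `W` Hausdorff), the closed collar is closed. [folklore] -/
theorem isClosed_slab [CompactSpace A] [T2Space W] (s : I) : IsClosed (κ.slab s) :=
  (κ.isCompact_slab s).isClosed

variable [Nonempty A]

/-- The collar pushes preserve the complement of a closed collar. [folklore] -/
theorem mapsTo_push_compl_slab (r s : I) : MapsTo (κ.push r) (κ.slab s)ᶜ (κ.slab s)ᶜ := by
  rintro w hw ⟨q, hq, hqw⟩
  by_cases hwr : w ∈ range κ.collar
  · obtain ⟨q', rfl⟩ := hwr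
    rw [push_collar] at hqw
    have h : q = (q'.1, max q'.2 r) := κ.injective hqw
    refine hw ⟨q', (?_ : q'.2 ≤ s), rfl⟩
    have hq' : q.2 = max q'.2 r := by rw [h]
    exact le_trans (hq' ▸ le_max_left q'.2 r : q'.2 ≤ q.2) hq
  · rw [κ.push_of_not_mem_range r hwr] at hqw
    exact hwr ⟨q, hqw⟩

/-- **The complement `W ∖ κ(A × [0, s])` of a closed collar (`s < 1`) is contractible when `W`
is**: it is stable under the collar pushes and the push to level `1` retracts `W` into it, so its
inclusion in `W` is a homotopy equivalence (`inclusionHomotopyEquiv`). [folklore] -/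
theorem contractibleSpace_compl_slab [ContractibleSpace W] {s : I} (hs : s < 1) :
    ContractibleSpace ↥((κ.slab s)ᶜ) :=
  ((κ.inclusionHomotopyEquiv 1 (κ.slab s)ᶜ univ (subset_univ _)
    (fun r _ => κ.mapsTo_push_compl_slab r s) (fun _ _ => mapsTo_univ _ _)
    (fun w _ => κ.core_subset_compl_slab hs (κ.push_mem_core 1 w))).trans
      (Homeomorph.Set.univ W).toHomotopyEquiv).contractibleSpace

/-- **Cofinality**: for `W` compact, every open `O ⊆ W` containing the core at level `t > 0`
contains the complement `W ∖ κ(A × [0, s])` of a closed collar for some `s < t`. Indeed `W ∖ O` is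
compact and lies in `κ(A × [0, t))`, so its (compact) set of levels is bounded away from `t`.
[folklore] -/
theorem exists_compl_slab_subset [CompactSpace W] {t : I} (ht : 0 < t) {O : Set W}
    (hO : IsOpen O) (hcore : κ.core t ⊆ O) : ∃ s : I, s < t ∧ (κ.slab s)ᶜ ⊆ O := by
  have hC : IsCompact Oᶜ := hO.isClosed_compl.isCompact
  have hCsub : Oᶜ ⊆ κ.below t := fun w hw => by
    by_contra h
    exact hw (hcore h)
  have hCr : Oᶜ ⊆ range κ.collar := hCsub.trans (κ.below_subset_range t)
  -- the levels of the compact set `W ∖ O ⊆ κ(A × [0, t))`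
  set L : Set I := (fun w => (κ.inv w).2) '' Oᶜ with hLdef
  have hL : IsCompact L :=
    hC.image_of_continuousOn ((continuous_snd.comp_continuousOn κ.continuousOn_inv).mono hCr)
  have hLt : ∀ l ∈ L, l < t := by
    rintro _ ⟨w, hw, rfl⟩
    obtain ⟨q, rfl⟩ := hCr hw
    have h : (κ.inv (κ.collar q)).2 < t := by
      rw [inv_collar]
      exact κ.collar_mem_below_iff.1 (hCsub hw)
    exact h
  rcases L.eq_empty_or_nonempty with hLe | hLne
  · -- `O = W`
    refine ⟨0, ht, fun w _ => ?_⟩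
    by_contra hw
    exact (Set.eq_empty_iff_forall_notMem.1 hLe _) ⟨w, hw, rfl⟩
  · obtain ⟨s, hsL, hs⟩ := hL.exists_isMaxOn hLne continuous_id.continuousOn
    refine ⟨s, hLt s hsL, fun w hw => ?_⟩
    by_contra hwO
    obtain ⟨q, rfl⟩ := hCr hwO
    have h2 : (κ.inv (κ.collar q)).2 ≤ s := hs ⟨_, hwO, rfl⟩
    rw [inv_collar] at h2
    exact hw ⟨q, h2, rfl⟩

/-- **Every open neighbourhood of a core contains a contractible open neighbourhood**, for `W`
compact contractible (Hausdorff) and `A` compact: namely `W ∖ κ(A × [0, s])` for a suitable `s < t`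
(`exists_compl_slab_subset`, `contractibleSpace_compl_slab`). [folklore] -/
theorem exists_contractible_open_nhd_core [CompactSpace W] [T2Space W] [ContractibleSpace W]
    [CompactSpace A] {t : I} (ht : 0 < t) {O : Set W} (hO : IsOpen O) (hcore : κ.core t ⊆ O) :
    ∃ V : Set W, IsOpen V ∧ κ.core t ⊆ V ∧ V ⊆ O ∧ V ⊆ κ.interior ∧ ContractibleSpace ↥V := by
  obtain ⟨s, hst, hsO⟩ := κ.exists_compl_slab_subset ht hO hcore
  exact ⟨(κ.slab s)ᶜ, (κ.isClosed_slab s).isOpen_compl, κ.core_subset_compl_slab hst, hsO,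
    κ.compl_slab_subset_interior s, κ.contractibleSpace_compl_slab (lt_of_lt_of_le hst t.2.2)⟩

end BoundaryCollar

end Literature.AlgebraicTopology.Homotopy
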